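import Summits.ResolutionOfSingularities.ResolutionOfSingularities.Theorems.RadicialJungCleanModelsCcurveQuotientDVR
import Summits.ResolutionOfSingularities.ResolutionOfSingularities.Theorems.RadicialJungCleanModelsCcurveUnitCaseFrac
import Summits.ResolutionOfSingularities.ResolutionOfSingularities.Theorems.RadicialJungCleanModelsCleanLU3CompositeFormOneLift
import Literature.FieldTheory.Separability.PDegreeSeparablyGenerated
import Literature.AlgebraicGeometry.Resolution.ValuationOverrings
import HarnessLib

/-!
# Route `RadicialJung`, crux `CleanModels` (stmt-15917) — (C-curve) sub-line: the `p`-degree-`p` representation modulo the centre curve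

Lead `res-B-lead-1` g6 (plan `Cruxes/CleanModels/Lines/Sketch-memo-Ccurve-plan.md` §1 S5a; hypothesis `hRep` of `Ccurve.persistForm2_of`).  OURS · counted 0.
Nothing here proves resolution in characteristic `p`; resolution in char `p` is NOT proved.

`pdegree_rep_locAtCentre`: `k` perfect of characteristic `p`; `B' ⊇ A` a finitely generated model in `O` with the centre of `O` maximal (`hzd`), `S' = locAtCentre B' O`
regular of dimension `3` with r.s.p. `(x, y, z)`, `O₁ ≥ O` a coarsening whose centre on `S'` is `(x, y)` and whose local ring on `B'` has dimension `2`.  Then every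
`w ∈ S'` satisfies `d^p w ≡ Σ_{j<p} w_j^p z^j (mod (x, y))` for some `d ∉ (x, y)`.  Route: `𝔮₁ = 𝔪_{O₁} ∩ B'` is a prime with `dim B'/𝔮₁ = 3 − 2 = 1`
(✓ `ringKrullDim_quotient_add_height`), so `[κ(𝔮₁) : κ(𝔮₁)^p] = p` (✓ `finrank_frobenius_residueField_eq_pow`, Matsumura 26.5 + 5.6); the localisation map
`φ : S' → κ(𝔮₁)` has kernel `(x, y)` and `φ(z)` is not a `p`-th power (✓ `uniformizer_not_pow` in the DVR `S'/(x, y)`, ✓ `quotient_span_pair_dvr`); so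
✓ `Ccurve.exists_sum_pow_mul_pow` writes `φ(w) = Σ ℓ_j^p φ(z)^j`, and clearing the denominators of the `ℓ_j` gives the claim.
-/

noncomputable section

set_option linter.dupNamespace false

open IsLocalRing Literature.AlgebraicGeometry.Resolution
open Summit.ResolutionOfSingularities.ResolutionOfSingularities.Theorems

namespace Summit.ResolutionOfSingularities.ResolutionOfSingularities.Theorems.RadicialJung.CleanModels.Ccurve

/-- **`p`-degree-`p` representation modulo the centre curve.**  See the module docstring. [folklore; cite: Matsumura1987, Thm. 26.5] -/
theorem pdegree_rep_locAtCentre :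
    ∀ (k : Type) [Field k] (K : Type) [Field K] [Algebra k K] [PerfectField k] (p : ℕ) [Fact p.Prime] [CharP k p]
    (O : ValuationSubring K) (A : Subalgebra k K), A.toSubring ≤ O.toSubring → A.FG →
    (∀ (T : Subring K) (hT : T ≤ O.toSubring), A.toSubring ≤ T → (subringCentre T O hT).IsMaximal) →
    ∀ (O₁ : ValuationSubring K), O ≤ O₁ →
    ∀ (B' : Subalgebra k K) (hB'O : B'.toSubring ≤ O.toSubring), A ≤ B' → B'.FG →
    IsRegularLocalRing (locAtCentre B'.toSubring O) → ringKrullDim (locAtCentre B'.toSubring O) = 3 →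
    ringKrullDim (locAtCentre B'.toSubring O₁) = 2 →
    ∀ (x y z : K) (hx : x ∈ locAtCentre B'.toSubring O) (hy : y ∈ locAtCentre B'.toSubring O) (hz : z ∈ locAtCentre B'.toSubring O),
      (haveI := isLocalRing_locAtCentre hB'O; IsLocalRing.maximalIdeal (locAtCentre B'.toSubring O)) =
        Ideal.span {⟨x, hx⟩, ⟨y, hy⟩, ⟨z, hz⟩} →
      (∀ w : ↥(locAtCentre B'.toSubring O), O₁.valuation (w : K) < 1 ↔ w ∈ Ideal.span {(⟨x, hx⟩ : ↥(locAtCentre B'.toSubring O)), ⟨y, hy⟩}) →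
    ∀ w : ↥(locAtCentre B'.toSubring O), ∃ (d : ↥(locAtCentre B'.toSubring O)) (ws : Fin p → ↥(locAtCentre B'.toSubring O)),
      d ∉ Ideal.span {(⟨x, hx⟩ : ↥(locAtCentre B'.toSubring O)), ⟨y, hy⟩} ∧
      d ^ p * w - ∑ j : Fin p, ws j ^ p * (⟨z, hz⟩ : ↥(locAtCentre B'.toSubring O)) ^ (j : ℕ) ∈
        Ideal.span {(⟨x, hx⟩ : ↥(locAtCentre B'.toSubring O)), ⟨y, hy⟩} := by
  intro k _ K _ _ _ p hp _ O A _ _ hzd O₁ hOO₁ B' hB'O hAB' hB'fg hB'reg hB'dim hdim₁ x y z hx hy hz hmax hcen w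
  classical
  -- the model `A₀ = B'` as a finitely generated `k`-algebra, its primes `𝔮 ⊇ 𝔮₁`
  letI : Algebra k B'.toSubring := inferInstanceAs (Algebra k B')
  haveI : Algebra.FiniteType k B'.toSubring := (B'.fg_iff_finiteType.mp hB'fg : Algebra.FiniteType k B')
  haveI := isLocalRing_locAtCentre hB'O
  haveI : IsRegularLocalRing ↥(locAtCentre B'.toSubring O) := hB'reg
  have hB'O₁ : B'.toSubring ≤ O₁.toSubring := fun w hw => hOO₁ (hB'O hw)
  set 𝔮 := subringCentre B'.toSubring O hB'O with h𝔮
  set 𝔮₁ := subringCentre B'.toSubring O₁ hB'O₁ with h𝔮₁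
  haveI h𝔮max : 𝔮.IsMaximal := hzd _ hB'O (fun w hw => hAB' hw)
  haveI h𝔮₁prime : 𝔮₁.IsPrime := subringCentre.isPrime _ _ hB'O₁
  haveI := isLocalization_locAtCentre (K := K) (O := O) hB'O
  haveI := isLocalization_locAtCentre (K := K) (O := O₁) hB'O₁
  have hv1 : ∀ {c : K}, O₁.valuation c < 1 → O.valuation c < 1 := fun {c} hc => by
    have h := valuation_lt_of_lt_of_le hOO₁ (x := c) (y := (1 : K)) (by rw [map_one]; exact hc)
    rw [map_one] at h; exact h
  have hv1' : ∀ {c : K}, c ∈ B'.toSubring → O.valuation c = 1 → O₁.valuation c = 1 := fun {c} hc hvc => by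
    refine le_antisymm ((O₁.valuation_le_one_iff _).mpr (hB'O₁ hc)) (not_lt.mp fun hlt => ?_)
    have h := hv1 hlt
    rw [hvc] at h; exact lt_irrefl _ h
  -- `dim B'/𝔮₁ = 1`
  have hdimB' : ringKrullDim ↥B'.toSubring = 3 := by
    have := ringKrullDim_locAtCentre_eq_of_isMaximal B' hB'fg O hB'O h𝔮max
    rw [hB'dim] at this; exact this.symm
  have hheight : (𝔮₁.height : WithBot ℕ∞) = 2 := by
    rw [← IsLocalization.AtPrime.ringKrullDim_eq_height 𝔮₁ ↥(locAtCentre B'.toSubring O₁)]; exact hdim₁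
  obtain ⟨s, hs, -⟩ := Literature.RingTheory.KrullDimension.exists_ringKrullDim_eq_and_trdeg_eq k (↥B'.toSubring ⧸ 𝔮₁)
  have hs1 : s = 1 := by
    have h2 := Literature.RingTheory.KrullDimension.ringKrullDim_quotient_add_height k (A := ↥B'.toSubring) 𝔮₁
    rw [hs, hheight, hdimB'] at h2
    have h3 : ((s + 2 : ℕ) : WithBot ℕ∞) = ((3 : ℕ) : WithBot ℕ∞) := by push_cast; exact h2
    have h4 : s + 2 = 3 := by exact_mod_cast h3
    omega
  rw [hs1] at hs
  -- the residue field `κ₁ = κ(𝔮₁)` and its `p`-degree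
  haveI : CharP 𝔮₁.ResidueField p :=
    charP_of_injective_ringHom ((algebraMap ↥B'.toSubring 𝔮₁.ResidueField).comp (algebraMap k ↥B'.toSubring)).injective p
  have hdeg : Module.finrank (frobenius 𝔮₁.ResidueField p).fieldRange 𝔮₁.ResidueField = p := by
    have := Literature.FieldTheory.Separability.finrank_frobenius_residueField_eq_pow (k := k) p 𝔮₁ (d := 1) (by exact_mod_cast hs)
    rw [pow_one] at this; exact this
  -- the localisation map `φ : S' → κ₁`
  set ψ := algebraMap ↥B'.toSubring 𝔮₁.ResidueField with hψ
  have hψ0 : ∀ a : ↥B'.toSubring, ψ a = 0 ↔ O₁.valuation (a : K) < 1 := fun a => by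
    rw [hψ, Ideal.algebraMap_residueField_eq_zero, h𝔮₁, mem_subringCentre_iff]
  have hunit : ∀ s : 𝔮.primeCompl, IsUnit (ψ s) := by
    intro s
    rw [isUnit_iff_ne_zero, Ne, hψ0]
    intro hlt
    exact s.2 ((mem_subringCentre_iff hB'O _).mpr (hv1 hlt))
  let φ : ↥(locAtCentre B'.toSubring O) →+* 𝔮₁.ResidueField := IsLocalization.lift (M := 𝔮.primeCompl) hunit
  have hφalg : ∀ a : ↥B'.toSubring, φ (algebraMap ↥B'.toSubring ↥(locAtCentre B'.toSubring O) a) = ψ a :=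
    fun a => IsLocalization.lift_eq hunit a
  -- fractions
  have hfrac : ∀ w : ↥(locAtCentre B'.toSubring O), ∃ a b : ↥B'.toSubring, O.valuation (b : K) = 1 ∧ (w : K) = a / b ∧
      w * algebraMap ↥B'.toSubring ↥(locAtCentre B'.toSubring O) b = algebraMap ↥B'.toSubring ↥(locAtCentre B'.toSubring O) a := by
    intro w
    obtain ⟨a, ha, b, hb, hvb, hw⟩ := mem_locAtCentre_iff.mp w.2
    refine ⟨⟨a, ha⟩, ⟨b, hb⟩, hvb, hw, Subtype.ext ?_⟩
    change (w : K) * ((algebraMap ↥B'.toSubring ↥(locAtCentre B'.toSubring O) ⟨b, hb⟩ : ↥(locAtCentre B'.toSubring O)) : K) =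
      ((algebraMap ↥B'.toSubring ↥(locAtCentre B'.toSubring O) ⟨a, ha⟩ : ↥(locAtCentre B'.toSubring O)) : K)
    rw [locAtCentre.algebraMap_apply, locAtCentre.algebraMap_apply]
    change (w : K) * b = a
    rw [hw]; field_simp [ne_zero_of_valuation_eq_one hvb]
  -- `ker φ = (x, y)`
  set P : Ideal ↥(locAtCentre B'.toSubring O) := Ideal.span {(⟨x, hx⟩ : ↥(locAtCentre B'.toSubring O)), ⟨y, hy⟩} with hP
  have hker : ∀ w : ↥(locAtCentre B'.toSubring O), φ w = 0 ↔ w ∈ P := by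
    intro w
    obtain ⟨a, b, hvb, hw, hwb⟩ := hfrac w
    have hb1 : O₁.valuation (b : K) = 1 := hv1' b.2 hvb
    have hψb : ψ b ≠ 0 := by rw [Ne, hψ0, hb1]; exact lt_irrefl _
    rw [← hcen w]
    have hφw : φ w * ψ b = ψ a := by rw [← hφalg b, ← map_mul, hwb, hφalg]
    have hva : O₁.valuation (w : K) = O₁.valuation (a : K) := by
      have : (a : K) = (w : K) * b := by rw [hw]; field_simp [ne_zero_of_valuation_eq_one hvb]
      rw [this, map_mul, hb1, mul_one]
    rw [hva, ← hψ0 a, ← hφw]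
    constructor
    · intro h; rw [h, zero_mul]
    · intro h; exact (mul_eq_zero.mp h).resolve_right hψb
  -- the DVR `D = S'/(x, y)` with uniformiser `z`
  have hd3 : (maximalIdeal ↥(locAtCentre B'.toSubring O)).spanFinrank = 3 := spanFinrank_eq_three_of_dim _ hB'dim
  have hrange : Ideal.span (Set.range ![(⟨x, hx⟩ : ↥(locAtCentre B'.toSubring O)), ⟨y, hy⟩, ⟨z, hz⟩]) =
      maximalIdeal ↥(locAtCentre B'.toSubring O) := by
    rw [hmax]; congr 1; ext v; simp only [Set.mem_range, Set.mem_insert_iff, Set.mem_singleton_iff]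
    constructor
    · rintro ⟨j, rfl⟩; fin_cases j <;> simp
    · rintro (rfl | rfl | rfl); exacts [⟨0, rfl⟩, ⟨1, rfl⟩, ⟨2, rfl⟩]
  obtain ⟨hdom, hdvr, hzirr⟩ := quotient_span_pair_dvr hd3 _ hrange
  change IsDomain (↥(locAtCentre B'.toSubring O) ⧸ P) at hdom
  change IsDiscreteValuationRing (↥(locAtCentre B'.toSubring O) ⧸ P) at hdvr
  change Irreducible (Ideal.Quotient.mk P ⟨z, hz⟩) at hzirr
  haveI := hdom
  haveI := hdvr
  -- elements of `κ₁` as fractions `ψ a / ψ b`, `b ∉ 𝔮₁`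
  have hκfrac : ∀ ℓ : 𝔮₁.ResidueField, ∃ a b : ↥B'.toSubring, ψ b ≠ 0 ∧ ℓ = ψ a / ψ b := by
    intro ℓ
    obtain ⟨a', b', hb', rfl⟩ := IsFractionRing.div_surjective (A := ↥B'.toSubring ⧸ 𝔮₁) ℓ
    obtain ⟨a, rfl⟩ := Ideal.Quotient.mk_surjective a'
    obtain ⟨b, rfl⟩ := Ideal.Quotient.mk_surjective b'
    refine ⟨a, b, ?_, ?_⟩
    · intro hb0
      apply nonZeroDivisors.ne_zero hb'
      rw [Ideal.Quotient.eq_zero_iff_mem, ← Ideal.algebraMap_residueField_eq_zero]; exact hb0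
    · rw [Ideal.algebraMap_quotient_residueField_mk, Ideal.algebraMap_quotient_residueField_mk]
  -- `φ z` is not a `p`-th power in `κ₁`
  set z₁ := φ ⟨z, hz⟩ with hz₁
  have hz₁pow : ∀ ℓ : 𝔮₁.ResidueField, ℓ ^ p ≠ z₁ := by
    intro ℓ hℓ
    obtain ⟨a, b, hψb, rfl⟩ := hκfrac ℓ
    rw [div_pow, div_eq_iff (pow_ne_zero _ hψb)] at hℓ
    set a' := algebraMap ↥B'.toSubring ↥(locAtCentre B'.toSubring O) a with ha'
    set b' := algebraMap ↥B'.toSubring ↥(locAtCentre B'.toSubring O) b with hb'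
    have hrel : a' ^ p - b' ^ p * ⟨z, hz⟩ ∈ P := by
      rw [← hker, map_sub, map_mul, map_pow, map_pow, hφalg, hφalg, ← hz₁, hℓ]
      ring
    have hb'P : b' ∉ P := by rw [← hker, hφalg]; exact hψb
    have hb'0 : Ideal.Quotient.mk P b' ≠ 0 := by rwa [Ne, Ideal.Quotient.eq_zero_iff_mem]
    apply uniformizer_not_pow (κ := FractionRing (↥(locAtCentre B'.toSubring O) ⧸ P)) p hzirr
      (algebraMap _ (FractionRing (↥(locAtCentre B'.toSubring O) ⧸ P)) (Ideal.Quotient.mk P a') /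
        algebraMap _ (FractionRing (↥(locAtCentre B'.toSubring O) ⧸ P)) (Ideal.Quotient.mk P b'))
    have hinj := IsFractionRing.injective (↥(locAtCentre B'.toSubring O) ⧸ P) (FractionRing (↥(locAtCentre B'.toSubring O) ⧸ P))
    have hbF : algebraMap _ (FractionRing (↥(locAtCentre B'.toSubring O) ⧸ P)) (Ideal.Quotient.mk P b') ≠ 0 :=
      fun h => hb'0 (hinj (by rw [h, map_zero]))
    have hq : Ideal.Quotient.mk P a' ^ p = Ideal.Quotient.mk P b' ^ p * Ideal.Quotient.mk P ⟨z, hz⟩ := by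
      have h := (Ideal.Quotient.eq (I := P)).mpr hrel
      rwa [map_pow, map_mul, map_pow] at h
    rw [div_pow, div_eq_iff (pow_ne_zero _ hbF),
      ← map_pow (algebraMap _ (FractionRing (↥(locAtCentre B'.toSubring O) ⧸ P))) (Ideal.Quotient.mk P a') p, hq, map_mul, map_pow]
    ring
  -- the representation in `κ₁`, denominators cleared
  obtain ⟨ℓs, hℓs⟩ := exists_sum_pow_mul_pow p hdeg z₁ hz₁pow (φ w)
  choose as bs hbs hℓ using fun j => hκfrac (ℓs j)
  set d : ↥B'.toSubring := ∏ j, bs j with hd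
  set ms : Fin p → ↥B'.toSubring := fun j => as j * ∏ i ∈ Finset.univ.erase j, bs i with hms
  have hψd : ψ d ≠ 0 := by
    rw [hd, map_prod]; exact Finset.prod_ne_zero_iff.mpr fun j _ => hbs j
  have hdm : ∀ j, ψ d * ℓs j = ψ (ms j) := by
    intro j
    rw [hℓ j, hms, hd, ← Finset.mul_prod_erase Finset.univ bs (Finset.mem_univ j), map_mul, map_mul]
    have hbj := hbs j
    field_simp
  have hident : ψ d ^ p * φ w = ∑ j : Fin p, ψ (ms j) ^ p * z₁ ^ (j : ℕ) := by
    rw [hℓs, Finset.mul_sum]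
    refine Finset.sum_congr rfl fun j _ => ?_
    rw [← hdm j, mul_pow]; ring
  refine ⟨algebraMap ↥B'.toSubring ↥(locAtCentre B'.toSubring O) d,
    fun j => algebraMap ↥B'.toSubring ↥(locAtCentre B'.toSubring O) (ms j), ?_, ?_⟩
  · rw [← hker, hφalg]; exact hψd
  · rw [← hker, map_sub, map_mul, map_pow, hφalg, map_sum, hident, ← sub_eq_zero.mpr rfl]
    congr 1
    refine Finset.sum_congr rfl fun j _ => ?_
    rw [map_mul, map_pow, map_pow, hφalg]

end Summit.ResolutionOfSingularities.ResolutionOfSingularities.Theorems.RadicialJung.CleanModels.Ccurve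

end
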